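import Literature.AnabelianGeometry.EtaleTheta.CyclotomeZHatAction
import HarnessLib

/-!
# `Ẑ`: elements are determined by their levels; every ABSTRACT endomorphism of `Ẑ` is continuous and
# determined by the image of `η(1)`; `Aut(Ẑ)` is determined by its cyclotomic characters

Classical complement to `CyclotomeZHatAction.lean` [RibesZalesskii2010, Thm 2.7.1] (`Ẑ = lim ℤ/nℤ`; `Ẑ^×`),
over Mathlib's `ProfiniteGrp.ProfiniteCompletion.completion (GrpCat.of (Multiplicative ℤ))` (= the tree's
`SemiGraphs.ZHat` / `IUT.HodgeTheaters.ZHat`). The abc-iut cell models `Ẑ^×` as the automorphism group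
`MulAut ZHat` of the ABSTRACT group `Ẑ` (`Literature.IUT.HodgeArakelov.ZHatUnits`, [IUTchII] Ex. 1.8 (iii)), its
docstring asserting "`Aut(Ẑ) = Ẑ^×`; every abstract automorphism of the topologically cyclic group `Ẑ` is
continuous". This file PROVES the kernel content of that modelling choice:

* `ZHatLevel.kerLevel_indexPNat_le` — `nℤ ⊆ H` for every finite-index subgroup `H ⊆ ℤ` of index `n`; hence
  `ZHatLevel.ext_of_proj` / `ext_of_level` — **an element of `Ẑ` is determined by its images in the `ℤ/nℤ`**
  (`n ≥ 1`);
* `ZHatLevel.monoidHom_ext_eta` — **two ABSTRACT endomorphisms of `Ẑ` agreeing on `η(1)` are equal** (the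
  pointed universal property of `Ẑ` WITHOUT any continuity hypothesis; strengthens abc-iut-L4's
  `ZHatCompletion.monoidHom_ext_of_continuous` for endomorphisms), and `eq_of_levelChar_eq` — **an automorphism
  of `Ẑ` is determined by its level cyclotomic characters `χ_n`** (so `Aut(Ẑ) ↪ lim (ℤ/nℤ)^× = Ẑ^×`);
* `ZHatLevel.continuous_monoidHom` — **every abstract endomorphism (in particular every abstract automorphism)
  of `Ẑ` is continuous** (it acts on each `ℤ/nℤ` by a scalar, `level_map`);
* `ZHatLevel.LevelFamily` (compatible families `(c_n ∈ ℤ/nℤ)_n`, i.e. elements of `lim_n ℤ/nℤ`), `powEnd c`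
  — the endomorphism `x ↦ x^c` of `Ẑ` (the `Ẑ`-MODULE structure of `Ẑ`), `toAdd_level_powEnd`; and for a unit
  family `autOfLevelFamily` with `levelChar_autOfLevelFamily` — **SURJECTIVITY: every compatible family of
  units `(c_n ∈ (ℤ/nℤ)^×)_n` is the cyclotomic character of an automorphism of `Ẑ`**; with
  `eq_of_levelChar_eq` and `autOfLevelFamily_ofAut`: `Aut(Ẑ) ≅ lim_n (ℤ/nℤ)^× = Ẑ^×` on the nose.

HONEST FRAMING: classical bookkeeping; nothing here bears on [IUTchIII] Cor. 3.12.
-/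

noncomputable section

open CategoryTheory ProfiniteGrp ProfiniteGrp.ProfiniteCompletion Topology

namespace Literature.AnabelianGeometry.EtaleTheta

namespace ZHatLevel

/-! ## Every finite-index subgroup of `ℤ` contains `nℤ`, `n` its index -/

/-- The index of a finite-index subgroup of `ℤ`, as a positive natural number.
[cite: RibesZalesskii2010, Thm 2.7.1] -/
def indexPNat (H : FiniteIndexNormalSubgroup (Multiplicative ℤ)) : ℕ+ :=
  ⟨H.toSubgroup.index, Nat.pos_of_ne_zero Subgroup.FiniteIndex.index_ne_zero⟩

/-- The underlying natural number of `indexPNat H` is the index of `H`.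
[cite: RibesZalesskii2010, Thm 2.7.1] -/
@[simp] theorem coe_indexPNat (H : FiniteIndexNormalSubgroup (Multiplicative ℤ)) :
    (indexPNat H : ℕ) = H.toSubgroup.index := rfl

/-- `nℤ ⊆ H` for a subgroup `H ⊆ ℤ` of finite index `n` (Lagrange: `g^n ∈ H`).
[cite: RibesZalesskii2010, Thm 2.7.1] -/
theorem kerLevel_indexPNat_le (H : FiniteIndexNormalSubgroup (Multiplicative ℤ)) :
    kerLevel (indexPNat H) ≤ H := by
  intro k hk
  have hk' : k ∈ kerLevel (indexPNat H) := hk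
  rw [mem_kerLevel_iff] at hk'
  obtain ⟨j, hj⟩ := hk'
  have hkj : k = Multiplicative.ofAdd j ^ H.toSubgroup.index := by
    rw [← ofAdd_nsmul, nsmul_eq_mul]
    change k = Multiplicative.ofAdd (((indexPNat H : ℕ) : ℤ) * j)
    rw [← hj, ofAdd_toAdd]
  rw [hkj]
  exact (FiniteIndexNormalSubgroup.mem_toSubgroup_iff).mp (H.toSubgroup.pow_index_mem _)

/-! ## Elements of `Ẑ` are determined by their levels -/

/-- The `H`-component of `x ∈ Ẑ` is the image of its level-`n` component, `n` the index of `H` (compatibility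
of the limit). [cite: RibesZalesskii2010, Thm 2.7.1] -/
theorem val_eq_map_proj (x : completion (GrpCat.of (Multiplicative ℤ)))
    (H : FiniteIndexNormalSubgroup (Multiplicative ℤ)) :
    (x.val H : Multiplicative ℤ ⧸ H.toSubgroup) =
      QuotientGroup.map (kerLevel (indexPNat H)).toSubgroup H.toSubgroup (MonoidHom.id _)
        (kerLevel_indexPNat_le H) (proj (indexPNat H) x) :=
  (x.prop (kerLevel_indexPNat_le H).hom).symm

/-- **An element of `Ẑ` is determined by its level projections `Ẑ → ℤ/nℤ`, `n ≥ 1`.**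
[cite: RibesZalesskii2010, Thm 2.7.1] -/
theorem ext_of_proj {x y : completion (GrpCat.of (Multiplicative ℤ))} (h : ∀ n : ℕ+, proj n x = proj n y) :
    x = y :=
  ProfiniteGrp.limit_ext _ x y fun H => by
    have hx := val_eq_map_proj x H
    have hy := val_eq_map_proj y H
    rw [h (indexPNat H)] at hx
    exact hx.trans hy.symm

/-- Level projections versus level characters: equal iff equal. [cite: RibesZalesskii2010, Thm 2.7.1] -/
theorem proj_eq_iff_level_eq {n : ℕ+} {x y : completion (GrpCat.of (Multiplicative ℤ))} :
    proj n x = proj n y ↔ level n x = level n y :=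
  ⟨fun h => by
      change QuotientGroup.kerLift (castMul n) (proj n x) = QuotientGroup.kerLift (castMul n) (proj n y)
      rw [h],
    fun h => QuotientGroup.kerLift_injective (castMul n) h⟩

/-- **An element of `Ẑ` is determined by its level characters `Ẑ → ℤ/nℤ`, `n ≥ 1`.**
[cite: RibesZalesskii2010, Thm 2.7.1] -/
theorem ext_of_level {x y : completion (GrpCat.of (Multiplicative ℤ))} (h : ∀ n : ℕ+, level n x = level n y) :
    x = y :=
  ext_of_proj fun n => proj_eq_iff_level_eq.2 (h n)

/-! ## Abstract endomorphisms of `Ẑ` -/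

/-- **Abstract pointed universal property (uniqueness)**: two ABSTRACT group endomorphisms of `Ẑ` that agree on
`η(1)` are equal — no continuity assumed (each acts on every level `ℤ/nℤ` by the scalar given by the image of
`η(1)`, `level_map`). [cite: RibesZalesskii2010, Thm 2.7.1] -/
theorem monoidHom_ext_eta
    {φ ψ : completion (GrpCat.of (Multiplicative ℤ)) →* completion (GrpCat.of (Multiplicative ℤ))}
    (h : φ (eta 1) = ψ (eta 1)) : φ = ψ :=
  MonoidHom.ext fun x => ext_of_level fun n => by
    apply Multiplicative.toAdd.injective
    rw [level_map n φ x, level_map n ψ x, h]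

/-- An endomorphism of `Ẑ` respects the fibres of every level projection.
[cite: RibesZalesskii2010, Thm 2.7.1] -/
theorem proj_map_eq_of_proj_eq
    (φ : completion (GrpCat.of (Multiplicative ℤ)) →* completion (GrpCat.of (Multiplicative ℤ))) (n : ℕ+)
    {x y : completion (GrpCat.of (Multiplicative ℤ))} (h : proj n x = proj n y) :
    proj n (φ x) = proj n (φ y) := by
  rw [proj_eq_iff_level_eq] at h ⊢
  apply Multiplicative.toAdd.injective
  rw [level_map n φ x, level_map n φ y, h]

/-- **Every ABSTRACT endomorphism of `Ẑ` is continuous** (so in particular every abstract automorphism: the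
tree's `ZHatUnits := MulAut ZHat` consists of homeomorphic automorphisms). Proof: the `H`-component of `φ x`
only depends on the level-`n` component of `x` (`n` = index of `H`), whose fibres are open.
[cite: RibesZalesskii2010, Thm 2.7.1] -/
theorem continuous_monoidHom
    (φ : completion (GrpCat.of (Multiplicative ℤ)) →* completion (GrpCat.of (Multiplicative ℤ))) :
    Continuous φ := by
  refine continuous_induced_rng.2 (continuous_pi fun H => ?_)
  haveI : DiscreteTopology ((diagram (GrpCat.of (Multiplicative ℤ))).obj H) := ⟨rfl⟩
  haveI : DiscreteTopology ((diagram (GrpCat.of (Multiplicative ℤ))).obj (kerLevel (indexPNat H))) := ⟨rfl⟩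
  have hc : Continuous fun x : completion (GrpCat.of (Multiplicative ℤ)) => x.val (kerLevel (indexPNat H)) :=
    Literature.AnabelianGeometry.AbsoluteAnabelian.ZHatCompletion.continuous_val (kerLevel (indexPNat H))
  refine continuous_def.2 fun U _ => isOpen_iff_forall_mem_open.2 fun x₀ hx₀ => ?_
  refine ⟨{x | x.val (kerLevel (indexPNat H)) = x₀.val (kerLevel (indexPNat H))}, ?_, ?_, rfl⟩
  · intro x hx
    have hx' : proj (indexPNat H) x = proj (indexPNat H) x₀ := hx
    have hφ : proj (indexPNat H) (φ x) = proj (indexPNat H) (φ x₀) :=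
      proj_map_eq_of_proj_eq φ (indexPNat H) hx'
    have hval : ((φ x).val H : Multiplicative ℤ ⧸ H.toSubgroup) = (φ x₀).val H := by
      rw [val_eq_map_proj (φ x) H, val_eq_map_proj (φ x₀) H, hφ]
    show (φ x).val H ∈ U
    rw [hval]
    exact hx₀
  · exact (isOpen_discrete {x₀.val (kerLevel (indexPNat H))}).preimage hc

/-- **Every abstract automorphism of `Ẑ` is a homeomorphism** (continuity of it and of its inverse).
[cite: RibesZalesskii2010, Thm 2.7.1] -/
theorem continuous_mulEquiv (φ : MulAut (completion (GrpCat.of (Multiplicative ℤ)))) :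
    Continuous φ ∧ Continuous φ.symm :=
  ⟨continuous_monoidHom φ.toMonoidHom, continuous_monoidHom φ.symm.toMonoidHom⟩

/-- The bicontinuous automorphism underlying an abstract automorphism of `Ẑ`.
[cite: RibesZalesskii2010, Thm 2.7.1] -/
def toContinuousMulEquiv (φ : MulAut (completion (GrpCat.of (Multiplicative ℤ)))) :
    completion (GrpCat.of (Multiplicative ℤ)) ≃ₜ* completion (GrpCat.of (Multiplicative ℤ)) :=
  { φ with
    continuous_toFun := (continuous_mulEquiv φ).1
    continuous_invFun := (continuous_mulEquiv φ).2 }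

/-- `toContinuousMulEquiv φ` is `φ` on elements. [cite: RibesZalesskii2010, Thm 2.7.1] -/
@[simp] theorem toContinuousMulEquiv_apply (φ : MulAut (completion (GrpCat.of (Multiplicative ℤ))))
    (x : completion (GrpCat.of (Multiplicative ℤ))) : toContinuousMulEquiv φ x = φ x := rfl

/-- Two abstract automorphisms of `Ẑ` agreeing on `η(1)` are equal. [cite: RibesZalesskii2010, Thm 2.7.1] -/
theorem mulEquiv_ext_eta {φ ψ : MulAut (completion (GrpCat.of (Multiplicative ℤ)))}
    (h : φ (eta 1) = ψ (eta 1)) : φ = ψ :=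
  MulEquiv.ext fun x =>
    DFunLike.congr_fun (monoidHom_ext_eta (φ := φ.toMonoidHom) (ψ := ψ.toMonoidHom) h) x

/-- **`Aut(Ẑ)` is determined by its cyclotomic characters**: two automorphisms with the same level-`n`
characters `χ_n` for all `n ≥ 1` are equal — i.e. `χ = (χ_n)_n : Aut(Ẑ) → lim_n (ℤ/nℤ)^× = Ẑ^×` is INJECTIVE
(the modelling `Ẑ^× := Aut(Ẑ)` loses nothing). [cite: RibesZalesskii2010, Thm 2.7.1] -/
theorem eq_of_levelChar_eq {φ ψ : MulAut (completion (GrpCat.of (Multiplicative ℤ)))}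
    (h : ∀ n : ℕ+, levelChar n φ = levelChar n ψ) : φ = ψ :=
  mulEquiv_ext_eta (ext_of_level fun n => Multiplicative.toAdd.injective (h n))

/-- Hence the twist on a cyclotome detects automorphisms LEVELWISE: if `u, v ∈ Aut(Ẑ)` act alike on every
cyclotome `Λ(A)` in the strong sense that their level characters agree, they are equal (contrapositive reading
of `eq_of_levelChar_eq` for consumers of `cyclotome.zhatTwist`). [cite: RibesZalesskii2010, Thm 2.7.1] -/
theorem levelChar_ne_of_ne {φ ψ : MulAut (completion (GrpCat.of (Multiplicative ℤ)))} (h : φ ≠ ψ) :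
    ∃ n : ℕ+, levelChar n φ ≠ levelChar n ψ := by
  by_contra hn
  exact h (eq_of_levelChar_eq fun n => not_not.mp (not_exists.mp hn n))

/-! ## Surjectivity: every compatible family of units is a cyclotomic character -/

/-- A COMPATIBLE FAMILY `(c_n ∈ ℤ/nℤ)_{n ≥ 1}` (`c_N mod n = c_n` for `n ∣ N`), i.e. an element of
`lim_n ℤ/nℤ = Ẑ` presented by its levels. [cite: RibesZalesskii2010, Thm 2.7.1] -/
structure LevelFamily : Type where
  /-- the level-`n` component -/
  c : ∀ n : ℕ+, ZMod n
  /-- compatibility under `ℤ/Nℤ → ℤ/nℤ`, `n ∣ N` -/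
  compat : ∀ (n N : ℕ+) (h : (n : ℕ) ∣ N), ZMod.castHom h (ZMod n) (c N) = c n

namespace LevelFamily

/-- Compatibility on `val`ues: `(c_N).val ≡ (c_n).val (mod n)` for `n ∣ N`.
[cite: RibesZalesskii2010, Thm 2.7.1] -/
theorem val_mod (f : LevelFamily) {n N : ℕ+} (h : (n : ℕ) ∣ N) : (f.c N).val % (n : ℕ) = (f.c n).val := by
  haveI : NeZero (N : ℕ) := NeZero.of_pos N.pos
  have h1 := f.compat n N h
  rw [ZMod.castHom_apply, ZMod.cast_eq_val] at h1
  have h2 := congrArg ZMod.val h1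
  rwa [ZMod.val_natCast] at h2

/-- Changing the index along an equality of positive naturals. [cite: RibesZalesskii2010, Thm 2.7.1] -/
theorem natCast_val_eq (f : LevelFamily) {N n : ℕ+} (h : N = n) : ((f.c N).val : ZMod n) = f.c n := by
  subst h
  haveI : NeZero (N : ℕ) := NeZero.of_pos N.pos
  exact ZMod.natCast_zmod_val _

/-- The cyclotomic characters of an automorphism of `Ẑ` form a compatible family.
[cite: RibesZalesskii2010, Thm 2.7.1] -/
def ofAut (φ : MulAut (completion (GrpCat.of (Multiplicative ℤ)))) : LevelFamily where
  c n := levelChar n φ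
  compat n N h := by
    obtain ⟨m, rfl⟩ : ∃ m : ℕ+, N = n * m := PNat.dvd_iff.2 h
    exact cast_levelChar_mul n m φ

/-- `(ofAut φ).c n = χ_n(φ)`. [cite: RibesZalesskii2010, Thm 2.7.1] -/
@[simp] theorem ofAut_c (φ : MulAut (completion (GrpCat.of (Multiplicative ℤ)))) (n : ℕ+) :
    (ofAut φ).c n = levelChar n φ := rfl

/-- The levels of an element `u ∈ Ẑ` form a compatible family (the presentation `Ẑ → lim_n ℤ/nℤ`; injective by
`ext_of_level`). `LevelFamily` is only this auxiliary presentation — no new avatar of `Ẑ` is intended.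
[cite: RibesZalesskii2010, Thm 2.7.1] -/
def ofZHat (u : completion (GrpCat.of (Multiplicative ℤ))) : LevelFamily where
  c n := Multiplicative.toAdd (level n u)
  compat n N h := by
    obtain ⟨m, rfl⟩ : ∃ m : ℕ+, N = n * m := PNat.dvd_iff.2 h
    exact cast_level_mul n m u

/-- `(ofZHat u).c n = level n u`. [cite: RibesZalesskii2010, Thm 2.7.1] -/
@[simp] theorem ofZHat_c (u : completion (GrpCat.of (Multiplicative ℤ))) (n : ℕ+) :
    (ofZHat u).c n = Multiplicative.toAdd (level n u) := rfl

/-- `ofZHat` is injective (`ext_of_level`). [cite: RibesZalesskii2010, Thm 2.7.1] -/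
theorem ofZHat_injective : Function.Injective ofZHat := fun u v h =>
  ext_of_level fun n => Multiplicative.toAdd.injective (by
    have := congrArg (fun f : LevelFamily => f.c n) h
    exact this)

end LevelFamily

/-- The index of `nℤ = Ker(ℤ → ℤ/nℤ)` is `n`. [cite: RibesZalesskii2010, Thm 2.7.1] -/
theorem index_kerLevel (n : ℕ+) : (kerLevel n).toSubgroup.index = n := by
  haveI : NeZero (n : ℕ) := NeZero.of_pos n.pos
  rw [kerLevel_toSubgroup, Subgroup.index_ker, MonoidHom.range_eq_top.mpr (castMul_surjective n),
    Subgroup.card_top, Nat.card_congr (Multiplicative.toAdd : Multiplicative (ZMod n) ≃ ZMod n)]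
  exact Nat.card_zmod n

/-- `indexPNat (kerLevel n) = n`. [cite: RibesZalesskii2010, Thm 2.7.1] -/
theorem indexPNat_kerLevel (n : ℕ+) : indexPNat (kerLevel n) = n :=
  PNat.eq (index_kerLevel n)

/-- A component `x_H ∈ ℤ/H` of an element of `Ẑ` is killed by the index of `H`.
[cite: RibesZalesskii2010, Thm 2.7.1] -/
theorem val_pow_index (x : completion (GrpCat.of (Multiplicative ℤ)))
    (H : FiniteIndexNormalSubgroup (Multiplicative ℤ)) :
    (x.val H : Multiplicative ℤ ⧸ H.toSubgroup) ^ (indexPNat H : ℕ) = 1 :=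
  pow_card_eq_one'

/-- **The endomorphism `x ↦ x^c` of `Ẑ`** for a compatible family `c = (c_n)_n` (the `Ẑ`-module structure of
`Ẑ`): componentwise `x_H ↦ x_H ^ c_{[ℤ:H]}` (well defined on the limit by the compatibility of `c`).
[cite: RibesZalesskii2010, Thm 2.7.1] -/
def powEnd (f : LevelFamily) :
    completion (GrpCat.of (Multiplicative ℤ)) →* completion (GrpCat.of (Multiplicative ℤ)) where
  toFun x :=
    ⟨fun H => x.val H ^ (f.c (indexPNat H)).val, fun H K π => by
      haveI : NeZero ((indexPNat K : ℕ+) : ℕ) := NeZero.of_pos (indexPNat K).pos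
      have hx : QuotientGroup.map H.toSubgroup K.toSubgroup (MonoidHom.id _) π.le
          (x.val H : Multiplicative ℤ ⧸ H.toSubgroup) = (x.val K : Multiplicative ℤ ⧸ K.toSubgroup) :=
        x.prop π
      -- push the power through any homomorphism `g` taking `x_H` to `x_K`, then compare exponents mod `[ℤ:K]`
      have key : ∀ g : Multiplicative ℤ ⧸ H.toSubgroup →* Multiplicative ℤ ⧸ K.toSubgroup,
          g (x.val H) = x.val K →
            g ((x.val H : Multiplicative ℤ ⧸ H.toSubgroup) ^ (f.c (indexPNat H)).val) =
              (x.val K : Multiplicative ℤ ⧸ K.toSubgroup) ^ (f.c (indexPNat K)).val :=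
        fun g hg => (map_pow g _ _).trans ((congrArg (fun t => t ^ (f.c (indexPNat H)).val) hg).trans
          (cyclotome.pow_val_eq_pow_of_mod_eq (val_pow_index x K)
            (by rw [f.val_mod (n := indexPNat K) (N := indexPNat H) (Subgroup.index_dvd_of_le π.le),
                  Nat.mod_eq_of_lt (ZMod.val_lt _)])))
      exact key _ hx⟩
  map_one' := ProfiniteGrp.limit_ext _ _ _ fun H =>
    @one_pow (Multiplicative ℤ ⧸ H.toSubgroup) _ _
  map_mul' x y := ProfiniteGrp.limit_ext _ _ _ fun H =>
    @mul_pow (Multiplicative ℤ ⧸ H.toSubgroup) _ (x.val H) (y.val H) _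

/-- Components of `powEnd`. [cite: RibesZalesskii2010, Thm 2.7.1] -/
theorem powEnd_val (f : LevelFamily) (x : completion (GrpCat.of (Multiplicative ℤ)))
    (H : FiniteIndexNormalSubgroup (Multiplicative ℤ)) :
    (powEnd f x).val H = x.val H ^ (f.c (indexPNat H)).val := rfl

/-- **`x ↦ x^c` acts on the level `n` as multiplication by `c_n`.** [cite: RibesZalesskii2010, Thm 2.7.1] -/
theorem toAdd_level_powEnd (f : LevelFamily) (n : ℕ+) (x : completion (GrpCat.of (Multiplicative ℤ))) :
    Multiplicative.toAdd (level n (powEnd f x)) = f.c n * Multiplicative.toAdd (level n x) := by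
  haveI : NeZero (n : ℕ) := NeZero.of_pos n.pos
  have h1 : level n (powEnd f x) = level n x ^ (f.c (indexPNat (kerLevel n))).val := by
    change QuotientGroup.kerLift (castMul n) (proj n (powEnd f x)) =
      QuotientGroup.kerLift (castMul n) (proj n x) ^ _
    rw [← map_pow]
    rfl
  rw [h1, toAdd_pow, nsmul_eq_mul, f.natCast_val_eq (indexPNat_kerLevel n)]

/-- **SURJECTIVITY of the cyclotomic character.** For compatible families `c`, `d` of units inverse to each
other (`c_n d_n = 1`), `x ↦ x^c` is an AUTOMORPHISM of `Ẑ` with inverse `x ↦ x^d`.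
[cite: RibesZalesskii2010, Thm 2.7.1] -/
def autOfLevelFamily (f g : LevelFamily) (hfg : ∀ n : ℕ+, f.c n * g.c n = 1) :
    MulAut (completion (GrpCat.of (Multiplicative ℤ))) where
  toFun := powEnd f
  invFun := powEnd g
  left_inv x := ext_of_level fun n => by
    apply Multiplicative.toAdd.injective
    rw [toAdd_level_powEnd, toAdd_level_powEnd, ← mul_assoc, mul_comm (g.c n), hfg, one_mul]
  right_inv x := ext_of_level fun n => by
    apply Multiplicative.toAdd.injective
    rw [toAdd_level_powEnd, toAdd_level_powEnd, ← mul_assoc, hfg, one_mul]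
  map_mul' := map_mul (powEnd f)

/-- … and its level-`n` cyclotomic character IS `c_n`: every compatible family of units is realised.
[cite: RibesZalesskii2010, Thm 2.7.1] -/
theorem levelChar_autOfLevelFamily (f g : LevelFamily) (hfg : ∀ n : ℕ+, f.c n * g.c n = 1) (n : ℕ+) :
    levelChar n (autOfLevelFamily f g hfg) = f.c n := by
  rw [levelChar_apply]
  change Multiplicative.toAdd (level n (powEnd f (eta 1))) = f.c n
  rw [toAdd_level_powEnd, level_eta, toAdd_ofAdd, Int.cast_one, mul_one]

/-- **`Aut(Ẑ) = Ẑ^×` on the nose**: the automorphism rebuilt from the characters of `φ` is `φ`.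
[cite: RibesZalesskii2010, Thm 2.7.1] -/
theorem autOfLevelFamily_ofAut (φ : MulAut (completion (GrpCat.of (Multiplicative ℤ)))) :
    autOfLevelFamily (LevelFamily.ofAut φ) (LevelFamily.ofAut φ⁻¹)
        (fun n => levelChar_mul_levelChar_inv n φ) = φ :=
  eq_of_levelChar_eq fun n => levelChar_autOfLevelFamily _ _ _ n

end ZHatLevel

end Literature.AnabelianGeometry.EtaleTheta

end
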